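import Literature.Combinatorics.Sahi2008.Functional

/-!
# Sahi (2008): `E_n` is multilinear

CITATION HEADER.  Sources: [Sahi2008, p. 211] (the `E_n` are "multilinear functionals"; Thm. 2 is extended from
principal up-sets to cumulations "by multilinearity"); [LiebSahi2021, §1 and §3.3] ("a sequence of multilinear
functionals `E_n(f_1,…,f_n)`"; "by multinearilty of `E_n`, for functions whose level sets are … rectangles");
[Blinovsky2013, p. 1] ("Since the functional `E_n(·)` is linear in each function `f_i` …").  What is proved: for
the tree's recursive definition `sahiE`, linearity in every slot (`sahiE_update_lin`, `sahiE_update_add`,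
`sahiE_update_smul`, `sahiE_update_zero`), by induction on `n` along the recursion (slot `0`: the recursion is
visibly linear in `f_0`; slot `k+1`: linearity of `E_{n+1}` in slot `k`, the diagonal term `j = k` and the
off-diagonal terms `j ≠ k` separately).  Manifest for Sahi's closed form; a theorem for the recursion.
-/

namespace Literature.Combinatorics.Sahi2008

open Finset Function

variable {α : Type*} [Fintype α]

/-- `E(a·g + b·h) = a·E(g) + b·E(h)` (plumbing for the multilinearity proof). [folklore] -/
private theorem ex_lin (μ : α → ℝ) (a b : ℝ) (g h : α → ℝ) :
    ex μ (a • g + b • h) = a * ex μ g + b * ex μ h := by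
  rw [ex_add, ex_smul, ex_smul]

/-- **`E_n` is linear in each slot**: `E_n(…, a·g + b·h, …) = a·E_n(…, g, …) + b·E_n(…, h, …)`.
[cite: Sahi2008, p. 211; LiebSahi2021, §1; Blinovsky2013, p. 1] -/
theorem sahiE_update_lin (μ : α → ℝ) : ∀ (n : ℕ) (f : Fin n → α → ℝ) (i : Fin n) (a b : ℝ) (g h : α → ℝ),
    sahiE μ n (update f i (a • g + b • h)) = a * sahiE μ n (update f i g) + b * sahiE μ n (update f i h)
  | 0, _, i, _, _, _, _ => i.elim0
  | 1, f, i, a, b, g, h => by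
    have hi : i = 0 := Subsingleton.elim i 0
    subst hi
    simp only [sahiE, update_self, ex_lin]
  | n + 2, f, i, a, b, g, h => by
    refine Fin.cases ?_ (fun k => ?_) i
    · -- slot `0`: the recursion is linear in `f 0`
      simp only [sahiE_succ_succ, Fin.tail_update_zero, update_self]
      have hmul : ∀ j : Fin (n + 1),
          Fin.tail f j * (a • g + b • h) = a • (Fin.tail f j * g) + b • (Fin.tail f j * h) := by
        intro j; funext x; simp only [Pi.mul_apply, Pi.add_apply, Pi.smul_apply, smul_eq_mul]; ring
      simp only [hmul, sahiE_update_lin μ (n + 1), ex_lin]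
      rw [sum_add_distrib, ← mul_sum, ← mul_sum]
      ring
    · -- slot `k.succ`: linearity of `E_{n+1}` in slot `k`
      simp only [sahiE_succ_succ, Fin.tail_update_succ]
      rw [update_of_ne (Fin.succ_ne_zero k).symm, update_of_ne (Fin.succ_ne_zero k).symm,
        update_of_ne (Fin.succ_ne_zero k).symm]
      set tf := Fin.tail f with htf
      have hterm : ∀ j : Fin (n + 1),
          sahiE μ (n + 1) (update (update tf k (a • g + b • h)) j (update tf k (a • g + b • h) j * f 0)) =
            a * sahiE μ (n + 1) (update (update tf k g) j (update tf k g j * f 0)) +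
              b * sahiE μ (n + 1) (update (update tf k h) j (update tf k h j * f 0)) := by
        intro j
        by_cases hjk : j = k
        · subst hjk
          simp only [update_self, update_idem]
          have hmul : (a • g + b • h) * f 0 = a • (g * f 0) + b • (h * f 0) := by
            funext x; simp only [Pi.mul_apply, Pi.add_apply, Pi.smul_apply, smul_eq_mul]; ring
          rw [hmul, sahiE_update_lin μ (n + 1)]
        · rw [update_of_ne hjk, update_of_ne hjk, update_of_ne hjk, update_comm (Ne.symm hjk),
            update_comm (Ne.symm hjk), update_comm (Ne.symm hjk), sahiE_update_lin μ (n + 1)]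
      simp only [hterm, sahiE_update_lin μ (n + 1)]
      rw [sum_add_distrib, ← mul_sum, ← mul_sum]
      ring

/-- Additivity in each slot. [cite: Sahi2008, p. 211; Blinovsky2013, p. 1] -/
theorem sahiE_update_add (μ : α → ℝ) {n : ℕ} (f : Fin n → α → ℝ) (i : Fin n) (g h : α → ℝ) :
    sahiE μ n (update f i (g + h)) = sahiE μ n (update f i g) + sahiE μ n (update f i h) := by
  have key := sahiE_update_lin μ n f i 1 1 g h
  simp only [one_smul, one_mul] at key
  exact key

/-- Homogeneity in each slot. [cite: Sahi2008, p. 211; Blinovsky2013, p. 1] -/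
theorem sahiE_update_smul (μ : α → ℝ) {n : ℕ} (f : Fin n → α → ℝ) (i : Fin n) (c : ℝ) (g : α → ℝ) :
    sahiE μ n (update f i (c • g)) = c * sahiE μ n (update f i g) := by
  have key := sahiE_update_lin μ n f i c 0 g g
  simp only [zero_smul, add_zero, zero_mul] at key
  exact key

/-- A zero slot kills `E_n`. [cite: Sahi2008, p. 211] -/
theorem sahiE_update_zero (μ : α → ℝ) {n : ℕ} (f : Fin n → α → ℝ) (i : Fin n) :
    sahiE μ n (update f i 0) = 0 := by
  have key := sahiE_update_lin μ n f i 0 0 0 0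
  simp only [zero_smul, add_zero, zero_mul] at key
  exact key

/-- `SahiPositive μ n` extends from a generating cone: if `E_n ≥ 0` whenever slot `i` holds a member of a family
`S` (other slots fixed), it holds when slot `i` holds a nonnegative combination `a·g + b·h`, `g, h ∈ S`-good.
(The bookkeeping step of "by multilinearity" arguments.) [cite: Sahi2008, p. 211 (Thm. 2 via multilinearity)] -/
theorem sahiE_update_nonneg_of_lin (μ : α → ℝ) {n : ℕ} (f : Fin n → α → ℝ) (i : Fin n) {a b : ℝ}
    (ha : 0 ≤ a) (hb : 0 ≤ b) {g h : α → ℝ} (hg : 0 ≤ sahiE μ n (update f i g))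
    (hh : 0 ≤ sahiE μ n (update f i h)) : 0 ≤ sahiE μ n (update f i (a • g + b • h)) := by
  rw [sahiE_update_lin]
  exact add_nonneg (mul_nonneg ha hg) (mul_nonneg hb hh)

end Literature.Combinatorics.Sahi2008
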